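import Literature.Analysis.ValidatedNumerics.RumpEigenvalueClusterInclusion
import Literature.LinearAlgebra.Matrix.InvariantSubspaceCharpoly
import Literature.LinearAlgebra.Matrix.Diagonalization
import HarnessLib

/-!
# Rump 2010 (13.46), the COUNT clause: "there are `k` eigenvalues of `A` in `U_r(λ̃)`", counted with
# algebraic multiplicity

Topic `Literature/Analysis/ValidatedNumerics`; namespace
`Literature.Analysis.ValidatedNumerics.RumpEigenCluster` (companion of `RumpEigenvalueClusterInclusion`,
which types Thm 13.9 — `thm_13_9`: `A Ŷ = Ŷ M̂`, `Ŷ` of full column rank, `M̂ = λ̃ I_k + Vᵀ X̂` — and the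
PER-EIGENVALUE clause of (13.46) — `eigenvalue_mem_disc_spectralRadius`: every complex eigenvalue `μ`
of `M̂` has `|μ − λ̃| ≤ ϱ(Δ)` — and whose docstring records that the COUNT "k eigenvalues with
multiplicity" was NOT typed; certnum-ref-2's verdict on p465400 repeats that disclosure).

SOURCE, read on the page. S. M. Rump, *Verification methods: rigorous results using floating-point
arithmetic*, Acta Numerica 19 (2010) 287–449 [Rump2010Verification], §13.4, held copy
`paper:url-cae7890f58e7` p0171 (printed p. 104) L26–L42:
"It remains to compute an inclusion of the eigenvalue cluster, that is, an inclusion of the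
eigenvalues of `M̂`. … For an interval matrix `C ∈ 𝕀K^{k×k}`, denote by `|C| ∈ ℝ^{k×k}` the matrix of
the entrywise maximum modulus of `C`. … Then, for `r := ϱ(|Vᵀ𝐗|)` there are `k` eigenvalues of `A` in
`U_r(λ̃) := {z ∈ ℂ : |z − λ̃| ≤ r}` (13.46), where `ϱ` denotes the spectral radius, in this case the
Perron root of `|Vᵀ𝐗| ∈ ℝ^{k×k}` … To see (13.46), observe that for `M̂ = λ̃ I_k + M̃`, for some
`M̃ ∈ Vᵀ𝐗`, the eigenvalues of `M̂` are the eigenvalues of `M̃` shifted by `λ̃`, and for any eigenvalue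
`μ` of `M̃`, Perron–Frobenius theory implies `|μ| ≤ ϱ(M̃) ≤ ϱ(|M̃|) ≤ ϱ(|Vᵀ𝐗|) = r`."  (Thm 13.9,
p0170 L37–p0171 L11: "the Jordan canonical form of `M̂` is identical to a `k × k` principal submatrix
of the Jordan canonical form of `A` … `Ŷ` has full rank and is a basis for an invariant subspace of
`A`.")

WHAT IS TYPED. "`k` eigenvalues of `A`, counted with (algebraic) multiplicity" is rendered with
Mathlib's `Matrix.charpoly` over `ℂ`: the multiset of complex roots of `p_{M̂}` has `card k` elements,
is a SUB-MULTISET of the multiset of complex roots of `p_A` (this is the spectral content of "the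
Jordan form of `M̂` is a principal submatrix of the Jordan form of `A`" at the level of algebraic
multiplicities — the finer Jordan-block statement is NOT typed), and each of its elements lies in the
closed disc `U_r(λ̃)`, `r = ϱ(Δ)` for any entrywise bound `Δ ≥ |M̃|`:
* `card_roots_charpoly_le_roots_mem_disc` — from the CONCLUSION data of Thm 13.9 (`A Y = Y (λ̃ 1 + M̃)`,
  `Y.mulVec` injective, `|M̃ᵢⱼ| ≤ Δᵢⱼ`), via the tree's
  `Literature.LinearAlgebra.Matrix.charpoly_map_roots_le_of_mul_eq_mul` (`p_{M̂} ∣ p_A`),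
  `card_roots_charpoly_map_eq`, `exists_mulVec_eq_smul_of_isRoot_charpoly` (root ⇒ eigenvector) and
  `eigenvalue_mem_disc_spectralRadius`;
* `thm_13_9_count` — assembled with `thm_13_9` from its HYPOTHESES (the two-variable range test of
  (13.43)–(13.44)) and an entrywise bound `Δ` of `Vᵀ𝐗` over the box `𝐗 = [L, Uu]` (the printed
  `|Vᵀ𝐗|`, or any larger matrix).

NOT TYPED: the Jordan-block refinement of Thm 13.9; `K = ℂ` data (the tree's Thm 13.9 is the real case).

SEARCH RECORD (dedup, 2026-08-26): `RumpEigenvalueClusterInclusion` (thm_13_9, hasEigenvalue_of_repr,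
eigenvalue_mem_disc_of_collatz, eigenvalue_mem_disc_spectralRadius — no count);
`InvariantSubspaceCharpoly` (landed today, the divisibility); `Diagonalization`
(`exists_mulVec_eq_smul_of_isRoot_charpoly`); Mathlib `Polynomial.mem_roots'`. Nothing restated.

## References

* S. M. Rump, Verification methods: rigorous results using floating-point arithmetic, Acta Numerica 19
  (2010) 287–449, Thm 13.9 and §13.4 (13.46). [Rump2010Verification]
* R. A. Horn, C. R. Johnson, *Matrix Analysis*, 2nd ed., CUP (2013), §1.3 (1.3.17)–Obs 1.3.18 (the
  block triangular form behind `p_{M̂} ∣ p_A`). [HornJohnson2013]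
-/

namespace Literature.Analysis.ValidatedNumerics.RumpEigenCluster

open Matrix

variable {n k : Type*} [Fintype n] [Fintype k] [DecidableEq n] [DecidableEq k]

/-- **Rump 2010 (13.46), count clause, from the conclusion of Thm 13.9.** Let `A Y = Y M̂` with
`M̂ = λ̃ 1 + M̃`, `Y.mulVec` injective (the full-rank basis `Ŷ` of the invariant subspace), and
`|M̃ᵢⱼ| ≤ Δᵢⱼ`. Then, over `ℂ`: the characteristic polynomial of `M̂` has exactly `card k` roots counted
with multiplicity; this multiset of roots is contained, WITH MULTIPLICITY, in the multiset of roots of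
the characteristic polynomial of `A` ("there are `k` eigenvalues of `A`"); and every one of them lies in
`U_r(λ̃)`, `r = ϱ(Δ)` ("in `U_r(λ̃) := {z ∈ ℂ : |z − λ̃| ≤ r}`", `ϱ` = spectral radius of `Δ` in
`M_k(ℂ)`, the Perron root). [cite: Rump2010Verification, §13.4 (13.46)] -/
theorem card_roots_charpoly_le_roots_mem_disc {A : Matrix n n ℝ} {Y : Matrix n k ℝ}
    {Mt Δ : Matrix k k ℝ} (lam : ℝ) (hAY : A * Y = Y * (lam • (1 : Matrix k k ℝ) + Mt))
    (hY : Function.Injective Y.mulVec) (hΔ : ∀ i j, |Mt i j| ≤ Δ i j) :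
    Multiset.card ((lam • (1 : Matrix k k ℝ) + Mt).map (algebraMap ℝ ℂ)).charpoly.roots =
        Fintype.card k ∧
      ((lam • (1 : Matrix k k ℝ) + Mt).map (algebraMap ℝ ℂ)).charpoly.roots ≤
        (A.map (algebraMap ℝ ℂ)).charpoly.roots ∧
      ∀ μ ∈ ((lam • (1 : Matrix k k ℝ) + Mt).map (algebraMap ℝ ℂ)).charpoly.roots,
        (‖μ - lam‖₊ : ENNReal) ≤ spectralRadius ℂ (Δ.map (algebraMap ℝ ℂ)) := by
  refine ⟨Literature.LinearAlgebra.Matrix.card_roots_charpoly_map_eq _ _,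
    Literature.LinearAlgebra.Matrix.charpoly_map_roots_le_of_mul_eq_mul _ hAY hY, fun μ hμ => ?_⟩
  have hroot := (Polynomial.mem_roots'.1 hμ).2
  obtain ⟨w, hw, hMw⟩ :=
    Literature.LinearAlgebra.Matrix.exists_mulVec_eq_smul_of_isRoot_charpoly _ hroot
  exact eigenvalue_mem_disc_spectralRadius hΔ lam hw hMw

/-- **Rump 2010 Thm 13.9 + (13.46) with the count, from the verification test.** Under the
hypotheses of `thm_13_9` (the range of the two-variable rendering of `f` in (13.43) maps the box
`𝐗 = [L, Uu]` into its interior) and any entrywise bound `Δ` of `Vᵀ X` over `X ∈ 𝐗` (the printed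
`|Vᵀ𝐗|`): there is `X̂ ∈ 𝐗` with `A Ŷ = Ŷ M̂` for `Ŷ = X̃ + UUᵀX̂`, `M̂ = λ̃ I_k + Vᵀ X̂`, `Ŷ` of full
column rank, AND "for `r := ϱ(|Vᵀ𝐗|)` there are `k` eigenvalues of `A` in `U_r(λ̃)`": the `card k`
complex roots of `p_{M̂}` (with multiplicity) form a sub-multiset of the complex roots of `p_A`, each
within `ϱ(Δ)` of `λ̃`. [cite: Rump2010Verification, Thm 13.9 and §13.4 (13.46)] -/
theorem thm_13_9_count [Nonempty k] (A R : Matrix n n ℝ) (Xt : Matrix n k ℝ) (lam : ℝ)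
    (v : k → n) (hv : Function.Injective v) {L Uu : Matrix n k ℝ} (hLU : ∀ i j, L i j ≤ Uu i j)
    (h : ∀ X₁ X₂, InBox L Uu X₁ → InBox L Uu X₂ → InInt L Uu (fMap A R Xt lam v X₁ X₂))
    {Δ : Matrix k k ℝ} (hΔ : ∀ X, InBox L Uu X → ∀ i j, |(vt v * X) i j| ≤ Δ i j) :
    ∃ Xh, InBox L Uu Xh ∧
      A * (Xt + uu v * Xh) = (Xt + uu v * Xh) * (lam • (1 : Matrix k k ℝ) + vt v * Xh) ∧
      Function.Injective (Xt + uu v * Xh).mulVec ∧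
      Multiset.card ((lam • (1 : Matrix k k ℝ) + vt v * Xh).map (algebraMap ℝ ℂ)).charpoly.roots =
        Fintype.card k ∧
      ((lam • (1 : Matrix k k ℝ) + vt v * Xh).map (algebraMap ℝ ℂ)).charpoly.roots ≤
        (A.map (algebraMap ℝ ℂ)).charpoly.roots ∧
      ∀ μ ∈ ((lam • (1 : Matrix k k ℝ) + vt v * Xh).map (algebraMap ℝ ℂ)).charpoly.roots,
        (‖μ - lam‖₊ : ENNReal) ≤ spectralRadius ℂ (Δ.map (algebraMap ℝ ℂ)) := by
  obtain ⟨-, Xh, hXh, -, hAY, hinj⟩ := thm_13_9 A R Xt lam v hv hLU h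
  obtain ⟨hcard, hle, hdisc⟩ := card_roots_charpoly_le_roots_mem_disc lam hAY hinj (hΔ Xh hXh)
  exact ⟨Xh, hXh, hAY, hinj, hcard, hle, hdisc⟩

end Literature.Analysis.ValidatedNumerics.RumpEigenCluster
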